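import Summits.QuantumFields.QCD.Theorems.GaussianLinkFramesFrameAPrioriBoundLineDefs
import Summits.QuantumFields.QCD.Theorems.PauliWegnerSeaPauliBandLimit
import Literature.MathematicalPhysics.QuantumLattice.GrassmannIntegralWilsonProofs
import Literature.Barriers.QuantumFields.CenterSymmetryBreakingByQuarks

/-!
# Crux `FrameAPrioriBound` (stmt-QuantumFields-17374), line `cube-cofactor` — stub `stub_blindVanish`

RIGIDITY AT ORDER ZERO.  On a torus `L ≥ 4`, a vector `h` on which the fibre family
`W ↦ hz (refit (touches x y) U W) m₀ z = γ₅ D_W(refit W; m₀, 1) − z` acts independently of `W`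
vanishes at every site of the two cubes `Q₂(x) ∪ Q₂(y)`.

Proof.  `(γ₅)² = 1` (`spinorLift_gammaFive_mul_self`) and the `z`-parts cancel, so the hypothesis
says `D_W(refit W) h = D_W(refit W') h` for all `W, W'` (`dirac_mulVec_eq_of_hz`).  Fix a cube site
`c` and the direction `μ = 0`.  The links `e₊ = (c, μ)` and `e₋ = (c − μ̂, μ)` are touched (an
endpoint in a cube), so re-sampling may replace either of them by any `g ∈ SU(3)` while keeping all
other links: `refit S U (W[e ↦ g]) = (refit S U W)[e ↦ g]` (`refit_update`).  By the link isolation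
`PauliBandLimit.wilsonDirac_update_apply` (`D_W(V[e ↦ g]) = A + (forward hop through e carrying
−½(1 − γ_μ) ⊗ g) + (backward hop carrying −½(1 + γ_μ) ⊗ g†)`), two re-samplings `g, g'` of one
link differ by the forward hop carrying `g − g'` plus the backward hop carrying `(g − g')†`
(`dirac_update_sub_apply`).  Take the central element `g = ω·1` (`ω³ = 1`, `ω ≠ 1`;
`Literature.Barriers.QuantumFields.scalarCenter`) against `g' = 1`, so `g − g' = (ω − 1)·1` is a
non-zero scalar in colour.  Reading `(D_W(V[e₊ ↦ g]) − D_W(V[e₊ ↦ 1])) h = 0` in the row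
`(c + μ̂, a, α)` gives `−½ (ω̄ − 1) Σ_β (1 + γ_μ)_{αβ} h(c, a, β) = 0` (the forward hop would need
`c + μ̂ = c`, excluded for `L ≥ 2`; `dirac_update_sub_mulVec_shift`), and reading the `e₋`-identity
in the row `(c − μ̂, a, α)` gives `−½ (ω − 1) Σ_β (1 − γ_μ)_{αβ} h(c, a, β) = 0`
(`dirac_update_sub_mulVec_base`).  Adding the two spin sums, `2 h(c, a, α) = 0`.
-/

noncomputable section

namespace Summit.QuantumFields.QCD.Cruxes.FrameAPrioriBound.CubeCofactor

open scoped BigOperators Matrix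
open MeasureTheory Filter Literature.MathematicalPhysics.QuantumFieldTheory
  Literature.MathematicalPhysics.QuantumLattice Literature.Probability.LatticeModels

namespace BlindVanish

variable {L : ℕ}

/-! ### Re-sampling one selected link -/

/-- Re-sampling one selected link: `refit S U (W[e ↦ g]) = (refit S U W)[e ↦ g]` when `S e`. -/
theorem refit_update (S : Edge 4 L → Bool) (U W : GaugeConfig 4 L SU3) (e : Edge 4 L) (g : SU3)
    (he : S e = true) :
    refit S U (Function.update W e g) = Function.update (refit S U W) e g := by
  funext e'
  by_cases h' : e' = e
  · subst h'
    simp [refit, he]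
  · simp [refit, Function.update_of_ne h']

/-! ### Removing `γ₅` and `z` -/

/-- `(γ₅)² = 1` and the `z`-parts cancel: `W`-independence of `(H − z) h` is `W`-independence of
`D_W h`. -/
theorem dirac_mulVec_eq_of_hz [NeZero L] {V V' : GaugeConfig 4 L SU3} {m₀ : ℝ} {z : ℂ}
    {h : TorusSite 4 L × Fin 3 × Fin 4 → ℂ} (H : hz V m₀ z *ᵥ h = hz V' m₀ z *ᵥ h) :
    wilsonDirac (fundamentalRep (Fin 3)) V m₀ 1 *ᵥ h =
      wilsonDirac (fundamentalRep (Fin 3)) V' m₀ 1 *ᵥ h := by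
  have H' : (spinorLift gammaFive * wilsonDirac (fundamentalRep (Fin 3)) V m₀ 1) *ᵥ h =
      (spinorLift gammaFive * wilsonDirac (fundamentalRep (Fin 3)) V' m₀ 1) *ᵥ h := by
    have H2 := H
    simp only [hz, Matrix.sub_mulVec] at H2
    exact sub_left_inj.mp H2
  have H2 : spinorLift gammaFive *ᵥ
        ((spinorLift gammaFive * wilsonDirac (fundamentalRep (Fin 3)) V m₀ 1) *ᵥ h) =
      spinorLift gammaFive *ᵥ
        ((spinorLift gammaFive * wilsonDirac (fundamentalRep (Fin 3)) V' m₀ 1) *ᵥ h) := by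
    rw [H']
  simpa only [Matrix.mulVec_mulVec, ← Matrix.mul_assoc,
    spinorLift_gammaFive_mul_self (L := L) (N := 3), Matrix.one_mul] using H2

/-! ### The two hops through one link -/

/-- LINK ISOLATION for a pair of re-samplings `g, g'` of one link `e = (x, μ)` (from
`PauliBandLimit.wilsonDirac_update_apply`): entrywise, the two Wilson–Dirac matrices differ by the
forward hop `−½ (1 − γ_μ) ⊗ (g − g')` from the rows at `x` to the columns at `x + μ̂` plus the
backward hop `−½ (1 + γ_μ) ⊗ (g − g')†` from the rows at `x + μ̂` to the columns at `x`. -/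
theorem dirac_update_sub_apply (V : GaugeConfig 4 L SU3) (m₀ : ℝ) (e : Edge 4 L) (g g' : SU3)
    (p q : TorusSite 4 L × Fin 3 × Fin 4) :
    (wilsonDirac (fundamentalRep (Fin 3)) (Function.update V e g) m₀ 1 -
        wilsonDirac (fundamentalRep (Fin 3)) (Function.update V e g') m₀ 1) p q =
      (if q.1 = Site.shift e.1 e.2 ∧ p.1 = e.1 then
          -(1 / 2 : ℂ) * ((1 - euclideanGamma e.2) p.2.2 q.2.2 *
            ((g : Matrix (Fin 3) (Fin 3) ℂ) - (g' : Matrix (Fin 3) (Fin 3) ℂ)) p.2.1 q.2.1)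
        else 0) +
      (if p.1 = Site.shift e.1 e.2 ∧ q.1 = e.1 then
          -(1 / 2 : ℂ) * ((1 + euclideanGamma e.2) p.2.2 q.2.2 *
            ((g : Matrix (Fin 3) (Fin 3) ℂ) - (g' : Matrix (Fin 3) (Fin 3) ℂ))ᴴ p.2.1 q.2.1)
        else 0) := by
  have key : ∀ A X₁ Y₁ X₂ Y₂ : ℂ, A + X₁ + Y₁ - (A + X₂ + Y₂) = (X₁ - X₂) + (Y₁ - Y₂) := by
    intros; ring
  rw [Matrix.sub_apply (wilsonDirac (fundamentalRep (Fin 3)) (Function.update V e g) m₀ 1),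
    Summit.QuantumFields.QCD.Theorems.PauliBandLimit.wilsonDirac_update_apply,
    Summit.QuantumFields.QCD.Theorems.PauliBandLimit.wilsonDirac_update_apply, key]
  simp only [Matrix.conjTranspose_apply, Matrix.sub_apply, star_sub]
  split_ifs <;> ring

/-- A fermion-index sum supported on the fibre over one site and diagonal in colour collapses to a
spin sum. -/
theorem sum_site_colour [NeZero L] (c : TorusSite 4 L) (a : Fin 3) (r κ : ℂ) (F : Fin 4 → ℂ)
    (h : TorusSite 4 L × Fin 3 × Fin 4 → ℂ) :
    ∑ q : TorusSite 4 L × Fin 3 × Fin 4,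
        (if q.1 = c then r * (F q.2.2 * (κ * if a = q.2.1 then 1 else 0)) else 0) * h q =
      r * κ * ∑ β, F β * h (c, a, β) := by
  rw [Fintype.sum_prod_type, Finset.sum_eq_single_of_mem c (Finset.mem_univ c)]
  · rw [Fintype.sum_prod_type, Finset.sum_eq_single_of_mem a (Finset.mem_univ a), Finset.mul_sum]
    · refine Finset.sum_congr rfl fun β _ => ?_
      simp only [if_true, mul_one]
      ring
    · intro b _ hb
      simp [Ne.symm hb]
  · intro s _ hs
    simp [hs]

/-- Row `x + μ̂` of the difference of two re-samplings `g, g'` of the link `(x, μ)` with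
`g − g' = κ · 1` (`x + μ̂ ≠ x`): only the backward hop survives,
`−½ κ̄ Σ_β (1 + γ_μ)_{αβ} h(x, a, β)`. -/
theorem dirac_update_sub_mulVec_shift [NeZero L] (V : GaugeConfig 4 L SU3) (m₀ : ℝ)
    (s : TorusSite 4 L) (μ : Fin 4) (hs : Site.shift s μ ≠ s) (g g' : SU3) (κ : ℂ)
    (hg : (g : Matrix (Fin 3) (Fin 3) ℂ) - (g' : Matrix (Fin 3) (Fin 3) ℂ) = κ • 1)
    (h : TorusSite 4 L × Fin 3 × Fin 4 → ℂ) (a : Fin 3) (α : Fin 4) :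
    ((wilsonDirac (fundamentalRep (Fin 3)) (Function.update V (s, μ) g) m₀ 1 -
        wilsonDirac (fundamentalRep (Fin 3)) (Function.update V (s, μ) g') m₀ 1) *ᵥ h)
        (Site.shift s μ, a, α) =
      -(1 / 2 : ℂ) * star κ * ∑ β, (1 + euclideanGamma μ) α β * h (s, a, β) := by
  simp only [Matrix.mulVec, dotProduct, dirac_update_sub_apply, hg, hs, and_false, if_false,
    zero_add, true_and, Matrix.conjTranspose_smul, Matrix.conjTranspose_one, Matrix.smul_apply,
    Matrix.one_apply, smul_eq_mul]
  exact sum_site_colour s a (-(1 / 2 : ℂ)) (star κ) ((1 + euclideanGamma μ) α) h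

/-- Row `x` of the difference of two re-samplings `g, g'` of the link `(x, μ)` with
`g − g' = κ · 1` (`x ≠ x + μ̂`): only the forward hop survives,
`−½ κ Σ_β (1 − γ_μ)_{αβ} h(x + μ̂, a, β)`. -/
theorem dirac_update_sub_mulVec_base [NeZero L] (V : GaugeConfig 4 L SU3) (m₀ : ℝ)
    (s : TorusSite 4 L) (μ : Fin 4) (hs : Site.shift s μ ≠ s) (g g' : SU3) (κ : ℂ)
    (hg : (g : Matrix (Fin 3) (Fin 3) ℂ) - (g' : Matrix (Fin 3) (Fin 3) ℂ) = κ • 1)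
    (h : TorusSite 4 L × Fin 3 × Fin 4 → ℂ) (a : Fin 3) (α : Fin 4) :
    ((wilsonDirac (fundamentalRep (Fin 3)) (Function.update V (s, μ) g) m₀ 1 -
        wilsonDirac (fundamentalRep (Fin 3)) (Function.update V (s, μ) g') m₀ 1) *ᵥ h)
        (s, a, α) =
      -(1 / 2 : ℂ) * κ * ∑ β, (1 - euclideanGamma μ) α β * h (Site.shift s μ, a, β) := by
  simp only [Matrix.mulVec, dotProduct, dirac_update_sub_apply, hg, hs.symm, false_and, if_false,
    add_zero, and_true, Matrix.smul_apply, Matrix.one_apply, smul_eq_mul]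
  exact sum_site_colour (Site.shift s μ) a (-(1 / 2 : ℂ)) κ ((1 - euclideanGamma μ) α) h

/-! ### The variation identities -/

/-- BACKWARD HOP (rows at `x + μ̂`): if re-sampling the link `(x, μ)` by `g` versus `g'` with
`g − g' = κ·1`, `κ ≠ 0`, does not change `D_W h`, then `Σ_β (1 + γ_μ)_{αβ} h(x, a, β) = 0`. -/
theorem plus_vanish [NeZero L] {V : GaugeConfig 4 L SU3} {m₀ : ℝ} {s : TorusSite 4 L} {μ : Fin 4}
    (hs : Site.shift s μ ≠ s) {g g' : SU3} {κ : ℂ}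
    (hg : (g : Matrix (Fin 3) (Fin 3) ℂ) - (g' : Matrix (Fin 3) (Fin 3) ℂ) = κ • 1) (hκ : κ ≠ 0)
    {h : TorusSite 4 L × Fin 3 × Fin 4 → ℂ}
    (HD : wilsonDirac (fundamentalRep (Fin 3)) (Function.update V (s, μ) g) m₀ 1 *ᵥ h =
      wilsonDirac (fundamentalRep (Fin 3)) (Function.update V (s, μ) g') m₀ 1 *ᵥ h)
    (a : Fin 3) (α : Fin 4) :
    ∑ β, (1 + euclideanGamma μ) α β * h (s, a, β) = 0 := by
  have H0 := congrFun (sub_eq_zero.mpr HD) (Site.shift s μ, a, α)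
  rw [← Matrix.sub_mulVec, Pi.zero_apply,
    dirac_update_sub_mulVec_shift V m₀ s μ hs g g' κ hg] at H0
  exact (mul_eq_zero.mp H0).resolve_left (mul_ne_zero (by norm_num) (star_ne_zero.mpr hκ))

/-- FORWARD HOP (rows at `x`): if re-sampling the link `(x, μ)` by `g` versus `g'` with
`g − g' = κ·1`, `κ ≠ 0`, does not change `D_W h`, then `Σ_β (1 − γ_μ)_{αβ} h(x + μ̂, a, β) = 0`. -/
theorem minus_vanish [NeZero L] {V : GaugeConfig 4 L SU3} {m₀ : ℝ} {s : TorusSite 4 L} {μ : Fin 4}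
    (hs : Site.shift s μ ≠ s) {g g' : SU3} {κ : ℂ}
    (hg : (g : Matrix (Fin 3) (Fin 3) ℂ) - (g' : Matrix (Fin 3) (Fin 3) ℂ) = κ • 1) (hκ : κ ≠ 0)
    {h : TorusSite 4 L × Fin 3 × Fin 4 → ℂ}
    (HD : wilsonDirac (fundamentalRep (Fin 3)) (Function.update V (s, μ) g) m₀ 1 *ᵥ h =
      wilsonDirac (fundamentalRep (Fin 3)) (Function.update V (s, μ) g') m₀ 1 *ᵥ h)
    (a : Fin 3) (α : Fin 4) :
    ∑ β, (1 - euclideanGamma μ) α β * h (Site.shift s μ, a, β) = 0 := by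
  have H0 := congrFun (sub_eq_zero.mpr HD) (s, a, α)
  rw [← Matrix.sub_mulVec, Pi.zero_apply,
    dirac_update_sub_mulVec_base V m₀ s μ hs g g' κ hg] at H0
  exact (mul_eq_zero.mp H0).resolve_left (mul_ne_zero (by norm_num) hκ)

end BlindVanish

open BlindVanish in
/-- STUB `blindVanish` (size M — rigidity at order zero).  On a torus `L ≥ 4`, a vector `h` on which
the fibre family `W ↦ H(refit W) − z` acts INDEPENDENTLY of `W` (equivalently: every variation of a
re-sampled link annihilates `h`) vanishes at every site of the two cubes `Q₂(x) ∪ Q₂(y)`.  For a cube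
site `c` the links `e₊ = (c, 0)` and `e₋ = (c − 0̂, 0)` are touched; comparing the re-samplings of
`e₊` (resp. `e₋`) by the central `ω·1` (`ω³ = 1 ≠ ω`) and by `1`, the backward hop read in the rows
at `c + 0̂` gives `Σ_β (1 + γ₀)_{αβ} h(c, a, β) = 0` and the forward hop read in the rows at `c − 0̂`
gives `Σ_β (1 − γ₀)_{αβ} h(c, a, β) = 0`; adding, `2 h(c, a, α) = 0`. -/
theorem stub_blindVanish : ∀ (L : ℕ) [NeZero L], 4 ≤ L → ∀ (m₀ : ℝ) (z : ℂ) (x y : TorusSite 4 L)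
    (U : GaugeConfig 4 L SU3) (h : TorusSite 4 L × Fin 3 × Fin 4 → ℂ),
    (∀ W W' : GaugeConfig 4 L SU3,
      (hz (refit (touches x y) U W) m₀ z) *ᵥ h = (hz (refit (touches x y) U W') m₀ z) *ᵥ h) →
    ∀ c : TorusSite 4 L, (inCube x c = true ∨ inCube y c = true) →
    ∀ (a : Fin 3) (i : Fin 4), h (c, a, i) = 0 := by
  intro L _ hL m₀ z x y U h H c hc a i
  -- on a torus of side `L ≥ 2` a unit shift moves every site
  haveI : Fact (1 < L) := ⟨by omega⟩
  have hs : ∀ (s : TorusSite 4 L) (μ : Fin 4), Site.shift s μ ≠ s := by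
    intro s μ h'
    have h1 : s + Pi.single μ (1 : ZMod L) = s := h'
    rw [add_eq_left, Pi.single_eq_zero_iff] at h1
    exact one_ne_zero h1
  -- the central element `ω · 1 ≠ 1` of `SU(3)`
  obtain ⟨ω, hω3, hω1⟩ := Literature.Barriers.QuantumFields.exists_root_of_unity_ne_one 3 (by norm_num)
  have hg : ((Literature.Barriers.QuantumFields.scalarCenter 3 ω hω3 (by norm_num) :
        SU3) : Matrix (Fin 3) (Fin 3) ℂ) - ((1 : SU3) : Matrix (Fin 3) (Fin 3) ℂ) = (ω - 1) • 1 := by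
    rw [sub_smul, one_smul]
    rfl
  have hκ : ω - 1 ≠ 0 := sub_ne_zero.mpr hω1
  -- the variation identity at every touched link
  have HD : ∀ e : Edge 4 L, touches x y e = true → ∀ g g' : SU3,
      wilsonDirac (fundamentalRep (Fin 3))
          (Function.update (refit (touches x y) U fun _ => 1) e g) m₀ 1 *ᵥ h =
        wilsonDirac (fundamentalRep (Fin 3))
          (Function.update (refit (touches x y) U fun _ => 1) e g') m₀ 1 *ᵥ h := by
    intro e he g g'
    have H1 := dirac_mulVec_eq_of_hz
      (H (Function.update (fun _ => 1) e g) (Function.update (fun _ => 1) e g'))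
    rwa [refit_update _ _ _ _ _ he, refit_update _ _ _ _ _ he] at H1
  -- the two touched links through `c` in direction `0`
  have hshift : Site.shift (c - Pi.single (0 : Fin 4) 1) 0 = c := sub_add_cancel c _
  have heP : touches x y (c, 0) = true := by
    rcases hc with hc | hc <;> simp [touches, hc]
  have heM : touches x y (c - Pi.single (0 : Fin 4) 1, 0) = true := by
    rcases hc with hc | hc <;> simp [touches, hshift, hc]
  have hplus := plus_vanish (hs c 0) hg hκ (HD _ heP _ _) a i
  have hminus := minus_vanish (hs _ 0) hg hκ (HD _ heM _ _) a i
  rw [hshift] at hminus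
  -- add the two spin sums: `(1 + γ₀) + (1 − γ₀) = 2`
  have key : ∀ β : Fin 4, (1 + euclideanGamma 0) i β + (1 - euclideanGamma 0) i β =
      if i = β then 2 else 0 := by
    intro β
    rw [Matrix.add_apply, Matrix.sub_apply, Matrix.one_apply]
    split_ifs <;> ring
  have hsum : ∑ β, ((1 + euclideanGamma 0) i β + (1 - euclideanGamma 0) i β) * h (c, a, β) = 0 := by
    simp only [add_mul, Finset.sum_add_distrib, hplus, hminus, add_zero]
  simp only [key, ite_mul, zero_mul, Finset.sum_ite_eq, Finset.mem_univ, if_true] at hsum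
  exact (mul_eq_zero.mp hsum).resolve_left two_ne_zero

end Summit.QuantumFields.QCD.Cruxes.FrameAPrioriBound.CubeCofactor

end
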